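import Literature.MathematicalPhysics.QuantumChemistry.ColemanOneMatrixRepresentability
import Literature.MathematicalPhysics.QuantumChemistry.OnePositivityFromTwoPositivity
import Literature.MathematicalPhysics.QuantumChemistry.RelaxationEnergyHierarchy
import Literature.MathematicalPhysics.QuantumChemistry.WeinholdWilsonInequalities
import HarnessLib

/-!
# The variational 2-RDM (DQG) lower bound is EXACT for one-body Hamiltonians

Topic `Literature/MathematicalPhysics/QuantumChemistry`; assembles three tree files into the
tightness statement that `VariationalRDMRelaxation.lean` lists as NOT formalised ("any statement about
HOW CLOSE the relaxation is") in the one case where the answer is classical: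

* `VariationalRDMRelaxation.lean` — the DQG programme is a LOWER bound
  (`le_groundEnergy_of_forall_isDQGFeasible`);
* `OnePositivityFromTwoPositivity.lean` — on the DQG-feasible set `0 ≤ γ` (every `N`) and `γ ≤ 1`
  (`r ≥ N + 2`): "the 2-positivity conditions imply the 1-positivity conditions", Mazziotti (2007)
  ch. 3 §II.B eqs. (16)–(17) (`IsDQGFeasible.one_posSemidef`, `IsDQGFeasible.one_sub_one_posSemidef`);
* `ColemanOneMatrixRepresentability.lean` — Coleman's SUFFICIENCY theorem: every `0 ≤ γ ≤ 1` with
  `tr γ = N` is the one-matrix of an ensemble of unit `N`-particle vectors (Coleman 1963;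
  Lieb–Seiringer Thm 3.2; Mazziotti §II.E.2).

D. A. Mazziotti, *Variational two-electron reduced-density-matrix theory*, Adv. Chem. Phys. 134 (2007)
ch. 3 §II.E.2 eqs. (52)–(59): the particle and hole 1-positivity conditions TOGETHER generate every
energy-shifted one-particle reduced Hamiltonian — i.e. the first-order (a fortiori the DQG) relaxation
is EXACT for one-body Hamiltonians (Coleman's theorem in dual form). Here, in the cell's bound form:

* `rdmEnergy_oneBody` — without two-body term (`g = 0`) the energy functional is the affine one-matrix
  functional `Σ_pq h_pq Σ_σ γ^{pσ}_{qσ} + h_nuc`;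
* **`groundEnergy_le_re_rdmEnergy_oneBody_of_le_one`** — for `g = 0`, every pair whose one-matrix obeys
  `γ ⪰ 0`, `1 − γ ⪰ 0`, `tr γ = N` has `E₀(Ĥ; N) ≤ Re E(γ, Γ)` (Coleman: `γ = Σ_a w_a ¹D(Ψ_a)`; the
  functional is affine; each member obeys the variational principle `E₀ ≤ Re ⟨Ψ_a|Ĥ|Ψ_a⟩`);
* **`IsDQGFeasible.groundEnergy_le_re_rdmEnergy_oneBody`** — the same for every DQG-feasible pair
  when `N + 2 ≤ 2|Λ|`;
* **`forall_isDQGFeasible_le_iff_oneBody`** — EXACTNESS: for `N + 2 ≤ 2|Λ|` and `g = 0`, a real `c` lies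
  below the functional on the whole DQG-feasible set iff `c ≤ E₀(Ĥ; N)`: the supremum of the
  certifiable variational-2-RDM lower bounds IS the ground-state energy — no relaxation gap for any
  one-body model (e.g. a Hubbard model at `U = 0`, or the bare one-electron part of a molecular
  Hamiltonian).

Everything is PROVED (0 sorry); no definitions, no named facts. NOT here: the `S_z`-sector version
(`IsDQGFeasibleSector`; it needs Coleman's construction sector by sector), attainment of the optimum,
the degenerate ranks `2|Λ| ∈ {N, N+1}`, and any tightness statement for interacting (`g ≠ 0`)
Hamiltonians (false in general).

## References
* D. A. Mazziotti, in: Reduced-Density-Matrix Mechanics, Adv. Chem. Phys. 134 (Wiley, 2007) 21–59,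
  §II.A eqs. (4)–(7), §II.B eqs. (16)–(17), §II.E.2 eqs. (52)–(59). [cite: Mazziotti2007RDMChapter, §II.E.2 eqs. (52)-(59)]
* A. J. Coleman, Rev. Mod. Phys. 35 (1963) 668; E. H. Lieb, R. Seiringer, *The Stability of Matter in
  Quantum Mechanics* (CUP, 2010), Thm 3.2 (ensemble `N`-representability of the 1-matrix).
  [cite: LiebSeiringer2009, Thm 3.2]
-/

noncomputable section

namespace Literature.MathematicalPhysics.QuantumChemistry

open Matrix Finset Literature.MathematicalPhysics.QuantumLattice
open scoped ComplexOrder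

/-! ### One-body Hamiltonians: the relaxation has no gap -/

section OneBody

variable {Λ : Type*} [LinearOrder Λ] [Fintype Λ]

omit [LinearOrder Λ] in
/-- Without two-body term the energy functional is the affine one-matrix functional
`E(γ, Γ) = Σ_pq h_pq Σ_σ γ^{pσ}_{qσ} + h_nuc` (independent of `Γ`). Mazziotti (2007) §II.A eqs. (4)–(7).
[cite: Mazziotti2007RDMChapter, §II.A eqs. (4)-(7)] -/
theorem rdmEnergy_oneBody (h : Λ → Λ → ℂ) (hnuc : ℂ) (γ : Matrix (Orb Λ) (Orb Λ) ℂ)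
    (Γ : Matrix (Orb Λ × Orb Λ) (Orb Λ × Orb Λ) ℂ) :
    rdmEnergy h 0 hnuc γ Γ = ∑ p, ∑ q, h p q * ∑ σ : Fin 2, γ (orb p σ) (orb q σ) + hnuc := by
  simp [rdmEnergy]

omit [LinearOrder Λ] in
/-- The one-matrix functional is linear: it commutes with finite weighted sums (plumbing).
[folklore] -/
private theorem oneBodySum_sum_smul {α : Type*} (h : Λ → Λ → ℂ) (s : Finset α) (c : α → ℂ)
    (M : α → Matrix (Orb Λ) (Orb Λ) ℂ) :
    ∑ p, ∑ q, h p q * ∑ σ : Fin 2, (∑ a ∈ s, c a • M a) (orb p σ) (orb q σ) =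
      ∑ a ∈ s, c a * ∑ p, ∑ q, h p q * ∑ σ : Fin 2, M a (orb p σ) (orb q σ) := by
  classical
  induction s using Finset.induction_on with
  | empty => simp
  | insert a s ha ih =>
    rw [Finset.sum_insert ha, Finset.sum_insert ha, ← ih]
    have hsplit : ∀ p q : Λ, ∀ σ : Fin 2,
        (c a • M a + ∑ x ∈ s, c x • M x) (orb p σ) (orb q σ) =
          c a * M a (orb p σ) (orb q σ) + (∑ x ∈ s, c x • M x) (orb p σ) (orb q σ) := by
      intro p q σ
      rw [Matrix.add_apply, Matrix.smul_apply, smul_eq_mul]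
    simp only [hsplit, Finset.sum_add_distrib, mul_add]
    congr 1
    simp only [Finset.mul_sum]
    refine Finset.sum_congr rfl fun p _ => Finset.sum_congr rfl fun q _ => Finset.sum_congr rfl fun σ _ => ?_
    ring

/-- **The first-order relaxation is exact for one-body Hamiltonians (Coleman form).** For a
Hamiltonian with no two-body part, every pair whose one-matrix obeys `γ ⪰ 0`, `1 − γ ⪰ 0`,
`tr γ = N` has energy functional `≥ E₀(Ĥ; N)`: by Coleman's theorem `γ = Σ_a w_a ¹D(Ψ_a)` for an
ensemble of unit `N`-particle vectors, the functional is affine in `γ`, and `Re ⟨Ψ_a|Ĥ|Ψ_a⟩ ≥ E₀`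
for each member. Mazziotti (2007) §II.E.2 eqs. (52)–(59) (the particle and hole extreme reduced
Hamiltonians generate every energy-shifted one-particle Hamiltonian).
[cite: Mazziotti2007RDMChapter, §II.E.2 eqs. (52)-(59)] -/
theorem groundEnergy_le_re_rdmEnergy_oneBody_of_le_one (h : Λ → Λ → ℂ) (hnuc : ℂ) {N : ℕ}
    {γ : Matrix (Orb Λ) (Orb Λ) ℂ} (hγ : γ.PosSemidef) (hγ' : (1 - γ).PosSemidef) (htr : γ.trace = N)
    (Γ : Matrix (Orb Λ × Orb Λ) (Orb Λ × Orb Λ) ℂ) :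
    groundEnergy (molecularHamiltonian h 0 hnuc) N ≤ (rdmEnergy h 0 hnuc γ Γ).re := by
  classical
  obtain ⟨w, Ψ, hmem, hw1, hγeq⟩ := (exists_ensemble_oneRDM_iff γ N).mpr ⟨hγ, hγ', htr⟩
  have hw1C : ∑ S ∈ univ.powersetCard N, (w S : ℂ) = 1 := by exact_mod_cast hw1
  -- the functional is affine: `E(γ) = Σ_S w_S E(¹D(Ψ_S)) = Σ_S w_S ⟨Ψ_S|Ĥ|Ψ_S⟩`
  have haff : rdmEnergy h 0 hnuc γ Γ =
      ∑ S ∈ univ.powersetCard N, (w S : ℂ) *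
        (star (Ψ S) ⬝ᵥ molecularHamiltonian h 0 hnuc *ᵥ Ψ S) := by
    calc rdmEnergy h 0 hnuc γ Γ
        = ∑ S ∈ univ.powersetCard N, (w S : ℂ) *
            (∑ p, ∑ q, h p q * ∑ σ : Fin 2, oneRDM (Ψ S) (orb p σ) (orb q σ)) + hnuc := by
          rw [rdmEnergy_oneBody, hγeq, oneBodySum_sum_smul]
      _ = ∑ S ∈ univ.powersetCard N, (w S : ℂ) *
            (∑ p, ∑ q, h p q * ∑ σ : Fin 2, oneRDM (Ψ S) (orb p σ) (orb q σ) + hnuc) := by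
          symm
          rw [Finset.sum_congr rfl fun S _ => mul_add ((w S : ℝ) : ℂ) _ hnuc, Finset.sum_add_distrib,
            ← Finset.sum_mul, hw1C, one_mul]
      _ = ∑ S ∈ univ.powersetCard N, (w S : ℂ) *
            (star (Ψ S) ⬝ᵥ molecularHamiltonian h 0 hnuc *ᵥ Ψ S) := by
          refine Finset.sum_congr rfl fun S hS => ?_
          rw [← rdmEnergy_oneBody h hnuc (oneRDM (Ψ S)) (twoRDM (Ψ S)),
            rdmEnergy_rdm h 0 hnuc (hmem S hS).2.2]
  rw [haff, Complex.re_sum]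
  simp only [Complex.re_ofReal_mul]
  calc groundEnergy (molecularHamiltonian h 0 hnuc) N
      = ∑ S ∈ univ.powersetCard N, w S * groundEnergy (molecularHamiltonian h 0 hnuc) N := by
        rw [← Finset.sum_mul, hw1, one_mul]
    _ ≤ ∑ S ∈ univ.powersetCard N,
          w S * (star (Ψ S) ⬝ᵥ molecularHamiltonian h 0 hnuc *ᵥ Ψ S).re :=
        Finset.sum_le_sum fun S hS => mul_le_mul_of_nonneg_left
          (ThermodynamicLimit.groundEnergy_le_re_expect _ (hmem S hS).2.1 (hmem S hS).2.2) (hmem S hS).1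

/-- **The DQG lower bound is exact for one-body Hamiltonians**: with `N + 2 ≤ 2|Λ|` the energy
functional at every DQG-feasible pair is `≥ E₀(Ĥ; N)` when `Ĥ` has no two-body part (2-positivity ⇒
1-positivity by contraction, then Coleman). Mazziotti (2007) §II.B eqs. (16)–(17), §II.E.2.
[cite: Mazziotti2007RDMChapter, §II.E.2 eqs. (52)-(59)] -/
theorem IsDQGFeasible.groundEnergy_le_re_rdmEnergy_oneBody (h : Λ → Λ → ℂ) (hnuc : ℂ) {N : ℕ}
    (hN : N + 2 ≤ Fintype.card (Orb Λ)) {γ : Matrix (Orb Λ) (Orb Λ) ℂ}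
    {Γ : Matrix (Orb Λ × Orb Λ) (Orb Λ × Orb Λ) ℂ} (hF : IsDQGFeasible N γ Γ) :
    groundEnergy (molecularHamiltonian h 0 hnuc) N ≤ (rdmEnergy h 0 hnuc γ Γ).re :=
  groundEnergy_le_re_rdmEnergy_oneBody_of_le_one h hnuc hF.one_posSemidef
    (hF.one_sub_one_posSemidef hN) hF.trace_one Γ

/-- **EXACTNESS (no relaxation gap for one-body Hamiltonians).** For `N + 2 ≤ 2|Λ|` and a
Hamiltonian with no two-body part, a real number lies below the energy functional on the whole
DQG-feasible set if and only if it lies below the exact ground-state energy `E₀(Ĥ; N)`: the supremum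
of the certifiable variational-2-RDM lower bounds IS `E₀`. (`→` is the relaxation bound
`le_groundEnergy_of_forall_isDQGFeasible`; `←` is Coleman's theorem.) Mazziotti (2007) §II.E.2.
[cite: Mazziotti2007RDMChapter, §II.E.2 eqs. (52)-(59)] -/
theorem forall_isDQGFeasible_le_iff_oneBody (h : Λ → Λ → ℂ) (hnuc : ℂ) {N : ℕ}
    (hN : N + 2 ≤ Fintype.card (Orb Λ)) (c : ℝ) :
    (∀ γ Γ, IsDQGFeasible N γ Γ → c ≤ (rdmEnergy h 0 hnuc γ Γ).re) ↔
      c ≤ groundEnergy (molecularHamiltonian h 0 hnuc) N :=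
  ⟨fun hc => le_groundEnergy_of_forall_isDQGFeasible h 0 hnuc (by omega) hc,
    fun hc _ _ hF => hc.trans (hF.groundEnergy_le_re_rdmEnergy_oneBody h hnuc hN)⟩

end OneBody

/-! ### The optimal values coincide with `E₀` for one-body Hamiltonians (appended 2026-08-22, same seat) -/

section Values

variable {Λ : Type*} [LinearOrder Λ] [Fintype Λ]

/-- **`E_PQG = E_fullCI` for one-body Hamiltonians**: with `N + 2 ≤ 2|Λ|` and no two-body part the
optimal value of the `P, Q, G` programme (`pqgEnergy`, `RelaxationEnergyHierarchy.lean`) EQUALS the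
exact `N`-electron ground-state energy. Mazziotti (2007) §II.E.2 (the 1-positivity conditions are
complete for one-particle Hamiltonians). [cite: Mazziotti2007RDMChapter, §II.E.2 eqs. (52)-(59)] -/
theorem pqgEnergy_eq_groundEnergy_oneBody (h : Λ → Λ → ℂ) (hnuc : ℂ) {N : ℕ}
    (hN : N + 2 ≤ Fintype.card (Orb Λ)) :
    pqgEnergy h 0 hnuc N = groundEnergy (molecularHamiltonian h 0 hnuc) N :=
  le_antisymm (pqgEnergy_le_groundEnergy h 0 hnuc (by omega))
    ((le_pqgEnergy_iff h 0 hnuc (by omega)).mpr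
      fun _ _ hF => hF.groundEnergy_le_re_rdmEnergy_oneBody h hnuc hN)

/-- **`E_PQG = E_PQGT1T2′ = E_fullCI` for one-body Hamiltonians**: the whole hierarchy collapses
(`E_PQG ≤ E_PQGT1T2′ ≤ E_fullCI = E_PQG`). Mazziotti (2007) §II.E.2; Nakata et al. (2008) §II.C for
the chain. [cite: Mazziotti2007RDMChapter, §II.E.2 eqs. (52)-(59)] -/
theorem pqgT1T2pEnergy_eq_groundEnergy_oneBody (h : Λ → Λ → ℂ) (hnuc : ℂ) {N : ℕ}
    (hN : N + 2 ≤ Fintype.card (Orb Λ)) :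
    pqgT1T2pEnergy h 0 hnuc N = groundEnergy (molecularHamiltonian h 0 hnuc) N :=
  le_antisymm (pqgT1T2pEnergy_le_groundEnergy h 0 hnuc (by omega))
    ((pqgEnergy_eq_groundEnergy_oneBody h hnuc hN).symm.le.trans
      (pqgEnergy_le_pqgT1T2pEnergy h 0 hnuc (by omega)))

end Values

/-! ### Every rank (appended 2026-08-22, same seat): `1 − γ ⪰ 0` holds on the DQG-feasible set without
the hypothesis `N + 2 ≤ 2|Λ|` (`IsDQGFeasible.one_sub_one_posSemidef'`, Ayers–Davidson (2007) §III.F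
eq. (56), `WeinholdWilsonInequalities.lean`), so the exactness statements need only a non-trivial
sector `N ≤ 2|Λ|` — and the pair form needs nothing. -/

section EveryRank

variable {Λ : Type*} [LinearOrder Λ] [Fintype Λ]

/-- **The DQG lower bound is exact for one-body Hamiltonians — every rank.** The energy functional at
every DQG-feasible pair is `≥ E₀(Ĥ; N)` when `Ĥ` has no two-body part; no hypothesis on `N` or `|Λ|`
(`γ ⪰ 0` by contraction, `1 − γ ⪰ 0` by the rotated `(2,2)` conditions, then Coleman).
Mazziotti (2007) §II.E.2 eqs. (52)–(59); Ayers–Davidson (2007) §III.F eq. (56).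
[cite: Mazziotti2007RDMChapter, §II.E.2 eqs. (52)-(59)] -/
theorem IsDQGFeasible.groundEnergy_le_re_rdmEnergy_oneBody' (h : Λ → Λ → ℂ) (hnuc : ℂ) {N : ℕ}
    {γ : Matrix (Orb Λ) (Orb Λ) ℂ} {Γ : Matrix (Orb Λ × Orb Λ) (Orb Λ × Orb Λ) ℂ}
    (hF : IsDQGFeasible N γ Γ) :
    groundEnergy (molecularHamiltonian h 0 hnuc) N ≤ (rdmEnergy h 0 hnuc γ Γ).re :=
  groundEnergy_le_re_rdmEnergy_oneBody_of_le_one h hnuc hF.one_posSemidef hF.one_sub_one_posSemidef'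
    hF.trace_one Γ

/-- **EXACTNESS in every rank**: for `N ≤ 2|Λ|` (non-empty sector) and no two-body part, a real
number lies below the energy functional on the whole DQG-feasible set iff it lies below `E₀(Ĥ; N)`.
Mazziotti (2007) §II.E.2. [cite: Mazziotti2007RDMChapter, §II.E.2 eqs. (52)-(59)] -/
theorem forall_isDQGFeasible_le_iff_oneBody' (h : Λ → Λ → ℂ) (hnuc : ℂ) {N : ℕ}
    (hN : N ≤ Fintype.card (Orb Λ)) (c : ℝ) :
    (∀ γ Γ, IsDQGFeasible N γ Γ → c ≤ (rdmEnergy h 0 hnuc γ Γ).re) ↔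
      c ≤ groundEnergy (molecularHamiltonian h 0 hnuc) N :=
  ⟨fun hc => le_groundEnergy_of_forall_isDQGFeasible h 0 hnuc hN hc,
    fun hc _ _ hF => hc.trans (hF.groundEnergy_le_re_rdmEnergy_oneBody' h hnuc)⟩

/-- **`E_PQG = E_fullCI` for one-body Hamiltonians, every rank** (`N ≤ 2|Λ|`).
Mazziotti (2007) §II.E.2. [cite: Mazziotti2007RDMChapter, §II.E.2 eqs. (52)-(59)] -/
theorem pqgEnergy_eq_groundEnergy_oneBody' (h : Λ → Λ → ℂ) (hnuc : ℂ) {N : ℕ}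
    (hN : N ≤ Fintype.card (Orb Λ)) :
    pqgEnergy h 0 hnuc N = groundEnergy (molecularHamiltonian h 0 hnuc) N :=
  le_antisymm (pqgEnergy_le_groundEnergy h 0 hnuc hN)
    ((le_pqgEnergy_iff h 0 hnuc hN).mpr fun _ _ hF => hF.groundEnergy_le_re_rdmEnergy_oneBody' h hnuc)

/-- **`E_PQGT1T2′ = E_fullCI` for one-body Hamiltonians, every rank** (`N ≤ 2|Λ|`).
Mazziotti (2007) §II.E.2; Nakata et al. (2008) §II.C. [cite: Mazziotti2007RDMChapter, §II.E.2 eqs. (52)-(59)] -/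
theorem pqgT1T2pEnergy_eq_groundEnergy_oneBody' (h : Λ → Λ → ℂ) (hnuc : ℂ) {N : ℕ}
    (hN : N ≤ Fintype.card (Orb Λ)) :
    pqgT1T2pEnergy h 0 hnuc N = groundEnergy (molecularHamiltonian h 0 hnuc) N :=
  le_antisymm (pqgT1T2pEnergy_le_groundEnergy h 0 hnuc hN)
    ((pqgEnergy_eq_groundEnergy_oneBody' h hnuc hN).symm.le.trans (pqgEnergy_le_pqgT1T2pEnergy h 0 hnuc hN))

end EveryRank

end Literature.MathematicalPhysics.QuantumChemistry

end
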